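import Summits.QuantumFields.YangMills.Theorems.ParabolicTrajectoryContinuumLimitOnTrajectoryStubOSLegsB_Limit
import Summits.QuantumFields.YangMills.Theorems.ParabolicTrajectoryContinuumLimitOnTrajectoryStubOSLegsC_Hermitian
import Summits.QuantumFields.YangMills.Theorems.ParabolicTrajectoryContinuumLimitOnTrajectoryDefsB

/-!
# Stub `stub_osLegs` (line `two-orbit-synchronisation`), part D: the corrected stub `OneFieldOSLegs'` PROVED
(`oneFieldOSLegs'`), closing the registered stub `stub_osPackaging` of skeleton v2 (the vocabulary `ARP`, `UCL`,
`OneFieldOSLegs'` lives in `…DefsB`)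
-/


set_option autoImplicit false

open scoped SchwartzMap
open MeasureTheory Filter Topology
open Literature.MathematicalPhysics.QuantumFieldTheory Literature.MathematicalPhysics.QuantumLattice
open Literature.MathematicalPhysics.AQFT Literature.Probability.LatticeModels
open Summit.QuantumFields.YangMills.Theses.ParabolicTrajectory

noncomputable section

namespace Summit.QuantumFields.YangMills.Cruxes.ContinuumLimitOnTrajectory.TwoOrbitSynchronisation

local notation "𝔼" => EuclideanSpace ℝ (Fin 4)

/-! ## §H  The corrected stub, PROVED: `OneFieldOSLegs'` (all legs class (i)) -/

section Assembly

variable {G : Type} [Group G] [TopologicalSpace G] [IsTopologicalGroup G] [CompactSpace G]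
  [MeasurableSpace G] [BorelSpace G]

/-- The data every leg consumes: one ultrafilter `𝒰 ≥ atTop` and the limit functionals `Λ p` with
`curvDistribution k p F → Λ p F` along `𝒰` on `⁰𝒮`. -/
structure LimitPkg (r : LatticeRep G) (sch : SpeciesScheme (YMSpecies G)) where
  𝒰 : Ultrafilter ℕ
  le_atTop : (𝒰 : Filter ℕ) ≤ atTop
  Λ : (p : ℕ) → 𝓢((Fin p → 𝔼), ℂ) →L[ℂ] ℂ
  lim : ∀ (p : ℕ) (F : 𝓢((Fin p → 𝔼), ℂ)), IsOffDiagonal F →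
    Tendsto (fun k => curvDistribution r sch k p F) 𝒰 (𝓝 (Λ p F))

namespace LimitPkg

variable {r : LatticeRep G} {sch : SpeciesScheme (YMSpecies G)} (P : LimitPkg r sch)

/-- The candidate Schwinger functions: zero-extension of the limit functionals. -/
abbrev S : LabelledSchwingerFamily (YMSpecies G) 𝔼 := zeroExt r P.Λ

/-- Limits along `atTop` are limits along `𝒰`. -/
theorem Λ_eq_of_tendsto {p : ℕ} {F : 𝓢((Fin p → 𝔼), ℂ)} (hF : IsOffDiagonal F) {c : ℂ}
    (h : Tendsto (fun k => curvDistribution r sch k p F) atTop (𝓝 c)) : P.Λ p F = c :=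
  tendsto_nhds_unique (P.lim p F hF) (h.mono_left P.le_atTop)

/-- Eventual bounds pass to the limit functional. -/
theorem norm_Λ_le {p : ℕ} {F : 𝓢((Fin p → 𝔼), ℂ)} (hF : IsOffDiagonal F) {b : ℝ}
    (h : ∀ᶠ k in atTop, ‖curvDistribution r sch k p F‖ ≤ b) : ‖P.Λ p F‖ ≤ b :=
  le_of_tendsto (P.lim p F hF).norm (P.le_atTop h)

/-- Eventual lower bounds pass to the limit functional. -/
theorem le_norm_Λ {p : ℕ} {F : 𝓢((Fin p → 𝔼), ℂ)} (hF : IsOffDiagonal F) {b : ℝ}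
    (h : ∀ᶠ k in atTop, b ≤ ‖curvDistribution r sch k p F‖) : b ≤ ‖P.Λ p F‖ :=
  ge_of_tendsto (P.lim p F hF).norm (P.le_atTop h)

/-- E0 normalisation of the limit. -/
theorem Λ_zero (F : 𝓢((Fin 0 → 𝔼), ℂ)) : P.Λ 0 F = F default :=
  P.Λ_eq_of_tendsto (isOffDiagonal_of_subsingleton F)
    (by simp_rw [curvDistribution_zero]; exact tendsto_const_nhds)

/-- One-point limits vanish (exact centring). -/
theorem Λ_one (F : 𝓢((Fin 1 → 𝔼), ℂ)) : P.Λ 1 F = 0 :=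
  P.Λ_eq_of_tendsto (isOffDiagonal_of_subsingleton F)
    (by simp_rw [curvDistribution_one]; exact tendsto_const_nhds)

/-- E3 for the limit functionals (exact at every `k`). -/
theorem Λ_permTest {p : ℕ} (π : Equiv.Perm (Fin p)) {F : 𝓢((Fin p → 𝔼), ℂ)} (hF : IsOffDiagonal F) :
    P.Λ p (permTest π F) = P.Λ p F :=
  tendsto_nhds_unique (P.lim p _ (isOffDiagonal_permTest hF π))
    (by simp_rw [curvDistribution_permTest]; exact P.lim p F hF)

/-- E0 (normalisation) of the zero-extension. -/
theorem normalized : P.S.IsNormalized := by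
  intro k F
  have hk : k = fun _ => r.curvature := funext fun i => i.elim0
  subst hk
  show zeroExt r P.Λ 0 (fun _ => r.curvature) F = _
  rw [zeroExt_curv, Λ_zero]
  exact congrArg F (Subsingleton.elim _ _)

/-- E3 of the zero-extension (exact lattice symmetry). -/
theorem symmetric : P.S.IsSymmetric := by
  intro n k π F hF
  show zeroExt r P.Λ n k (permTest π F) = zeroExt r P.Λ n (k ∘ π) F
  rcases labels_dichotomy r k with rfl | ⟨i, hi⟩
  · rw [show ((fun _ : Fin n => r.curvature) ∘ π) = fun _ => r.curvature from rfl, zeroExt_curv,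
      P.Λ_permTest π hF]
  · rw [zeroExt_of_ne r P.Λ hi, zeroExt_of_ne r P.Λ (σ := k ∘ π) (i := π.symm i) (by simpa using hi)]
    rfl

/-- E0' of the zero-extension (from `UVB`). -/
theorem linearGrowth {s : ℕ} {α β : ℝ} (hα : 0 ≤ α)
    (hbd : ∀ (p : ℕ) (F : 𝓢((Fin p → 𝔼), ℂ)), IsOffDiagonal F →
      ‖P.Λ p F‖ ≤ α * (p.factorial : ℝ) ^ β * schwartzNorm (p * s) F) :
    P.S.HasLinearGrowth := by
  intro T
  refine ⟨s, α, β, fun n k _ F hF => ?_⟩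
  show ‖zeroExt r P.Λ n k F‖ ≤ _
  rcases labels_dichotomy r k with rfl | ⟨i, hi⟩
  · rw [zeroExt_curv]; exact hbd n F hF
  · rw [zeroExt_of_ne r P.Λ hi]
    show ‖(0 : ℂ)‖ ≤ _
    rw [norm_zero]
    exact mul_nonneg (mul_nonneg hα (by positivity)) (schwartzNorm_nonneg _ _)

/-- E1 of the zero-extension (from `AsympEuclid`). -/
theorem invariant (hE1 : AsympEuclid r sch) : P.S.IsEuclideanInvariant := by
  refine ⟨fun n k a F hF => ?_, fun n k R hR F hF => ?_⟩
  · show zeroExt r P.Λ n k (translateMulti a F) = zeroExt r P.Λ n k F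
    rcases labels_dichotomy r k with rfl | ⟨i, hi⟩
    · rw [zeroExt_curv]
      have h := tendsto_nhds_unique ((P.lim n _ (isOffDiagonal_translateMulti hF a)).sub (P.lim n F hF))
        ((hE1.1 n F hF a).mono_left P.le_atTop)
      exact sub_eq_zero.1 h
    · rw [zeroExt_of_ne r P.Λ hi]; rfl
  · show zeroExt r P.Λ n k (linActMulti R F) = zeroExt r P.Λ n k F
    rcases labels_dichotomy r k with rfl | ⟨i, hi⟩
    · rw [zeroExt_curv]
      have h := tendsto_nhds_unique ((P.lim n _ (isOffDiagonal_linActMulti hF R)).sub (P.lim n F hF))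
        ((hE1.2 n F hF R hR).mono_left P.le_atTop)
      exact sub_eq_zero.1 h
    · rw [zeroExt_of_ne r P.Λ hi]; rfl

/-- E4 of the zero-extension (from `UCL`). -/
theorem cluster (hUCL : UCL r sch) : P.S.HasClusterProperty := by
  intro n m k k' F G' hF hG a ha0 ha H hH
  by_cases hk : (k = fun _ => r.curvature) ∧ (k' = fun _ => r.curvature)
  · obtain ⟨rfl, rfl⟩ := hk
    have hkey : ∀ t, P.S (n + m) (Fin.append ((fun _ : Fin n => r.curvature) ∘ Fin.rev) fun _ => r.curvature) (H t) -
        P.S n ((fun _ : Fin n => r.curvature) ∘ Fin.rev) (osAdjoint F) * P.S m (fun _ => r.curvature) G' =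
        P.Λ (n + m) (H t) - P.Λ n (osAdjoint F) * P.Λ m G' := by
      intro t
      show zeroExt r P.Λ (n + m) _ (H t) - zeroExt r P.Λ n _ (osAdjoint F) * zeroExt r P.Λ m _ G' = _
      rw [append_curv, show ((fun _ : Fin n => r.curvature) ∘ Fin.rev) = fun _ => r.curvature from rfl,
        zeroExt_curv, zeroExt_curv, zeroExt_curv]
    simp_rw [hkey]
    rw [Metric.tendsto_atTop]
    intro ε hε
    obtain ⟨t₀, ht₀⟩ := hUCL n m F G' hF hG a ha0 ha (ε / 2) (half_pos hε)
    refine ⟨t₀, fun t ht => ?_⟩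
    rw [dist_zero_right]
    have hv : 0 ≤ (t • a) 0 := by simp [ha0]
    have hHt : IsOffDiagonal (H t) := isOffDiagonal_of_isAppendTensorOf hF hG hv (hH t)
    have hθF : IsOffDiagonal (osAdjoint F) :=
      Literature.MathematicalPhysics.AQFT.IsOffDiagonal.of_tsupport_subset fun x hx =>
        Literature.MathematicalPhysics.AQFT.not_mem_coincidenceLocus_of_injective fun i j hij =>
          (tsupport_osAdjoint_subset hF hx).2 (by simp [hij])
    have hlim := ((P.lim (n + m) (H t) hHt).sub ((P.lim n _ hθF).mul (P.lim m G' hG.isOffDiagonal))).norm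
    have hb : ‖P.Λ (n + m) (H t) - P.Λ n (osAdjoint F) * P.Λ m G'‖ ≤ ε / 2 :=
      le_of_tendsto hlim (P.le_atTop (ht₀ t ht (H t) (hH t)))
    linarith
  · -- a non-curvature label: everything vanishes identically
    have hzero : ∀ t, P.S (n + m) (Fin.append (k ∘ Fin.rev) k') (H t) -
        P.S n (k ∘ Fin.rev) (osAdjoint F) * P.S m k' G' = 0 := by
      intro t
      show zeroExt r P.Λ (n + m) _ (H t) - zeroExt r P.Λ n _ (osAdjoint F) * zeroExt r P.Λ m _ G' = 0
      rcases labels_dichotomy r k with rfl | ⟨i, hi⟩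
      · rcases labels_dichotomy r k' with rfl | ⟨j, hj⟩
        · exact absurd ⟨rfl, rfl⟩ hk
        · rw [zeroExt_append_of_ne_right r P.Λ _ hj, zeroExt_of_ne r P.Λ hj]; simp
      · rw [zeroExt_append_of_ne_left r P.Λ _ hi,
          zeroExt_of_ne r P.Λ (σ := k ∘ Fin.rev) (i := Fin.rev i) (by simpa using hi)]
        simp
    simp_rw [hzero]
    exact tendsto_const_nhds

/-- E2 of the zero-extension (from `ARP`; strings touching another species drop out termwise). -/
theorem reflectionPositive (hARP : ARP r sch) : P.S.IsReflectionPositive := by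
  classical
  intro N deg lab F hF H hH
  -- drop the terms off the curvature block
  let good : Fin N → Prop := fun j => lab j = fun _ => r.curvature
  let F' : (j : Fin N) → 𝓢((Fin (deg j) → 𝔼), ℂ) := fun j => if good j then F j else 0
  let H' : (i j : Fin N) → 𝓢((Fin (deg i + deg j) → 𝔼), ℂ) := fun i j =>
    if good i ∧ good j then H i j else 0
  have hF' : ∀ j, IsTimeOrdered (F' j) := by
    intro j
    by_cases hj : good j
    · simp only [F', hj, if_true]; exact hF j
    · simp only [F', hj, if_false]
      intro x hx
      have h0 : tsupport ((0 : 𝓢((Fin (deg j) → 𝔼), ℂ)) : (Fin (deg j) → 𝔼) → ℂ) = ∅ :=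
        tsupport_eq_empty_iff.2 rfl
      rw [h0] at hx
      exact absurd hx (Set.notMem_empty x)
  have hH' : ∀ i j, IsAppendTensorOf (H' i j) (osAdjoint (F' i)) (F' j) := by
    intro i j x
    by_cases hij : good i ∧ good j
    · simp only [H', F', hij, if_true, and_self]; exact hH i j x
    · simp only [H', hij, if_false]
      rcases not_and_or.1 hij with hi | hj
      · simp [F', hi, osAdjoint_apply]
      · simp [F', hj]
  -- termwise convergence of the lattice sums to the OS sum
  have hterm : ∀ i j, Tendsto (fun k => curvDistribution r sch k (deg i + deg j) (H' i j)) P.𝒰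
      (𝓝 (P.S (deg i + deg j) (Fin.append (lab i ∘ Fin.rev) (lab j)) (H i j))) := by
    intro i j
    by_cases hij : good i ∧ good j
    · obtain ⟨hi, hj⟩ := hij
      have h1 : H' i j = H i j := by simp only [H', hi, hj, and_self, if_true]
      have h2 : P.S (deg i + deg j) (Fin.append (lab i ∘ Fin.rev) (lab j)) = P.Λ (deg i + deg j) := by
        show zeroExt r P.Λ _ _ = _
        rw [show lab i = fun _ => r.curvature from hi, show lab j = fun _ => r.curvature from hj,
          append_curv, zeroExt_curv]
      rw [h1, h2]
      exact P.lim _ _ (isOffDiagonal_of_isAppendTensorOf_zero (hF i) (hF j) (hH i j))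
    · have h1 : H' i j = 0 := by simp only [H', hij, if_false]
      have h2 : P.S (deg i + deg j) (Fin.append (lab i ∘ Fin.rev) (lab j)) (H i j) = 0 := by
        show zeroExt r P.Λ _ _ (H i j) = 0
        rcases not_and_or.1 hij with hi | hj
        · obtain ⟨i₀, hi₀⟩ : ∃ i₀, lab i i₀ ≠ r.curvature := by
            by_contra h; push Not at h; exact hi (funext h)
          rw [zeroExt_append_of_ne_left r P.Λ _ hi₀]; rfl
        · obtain ⟨j₀, hj₀⟩ : ∃ j₀, lab j j₀ ≠ r.curvature := by
            by_contra h; push Not at h; exact hj (funext h)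
          rw [zeroExt_append_of_ne_right r P.Λ _ hj₀]; rfl
      rw [h1, h2]
      simp_rw [curvDistribution_zero_fun]
      exact tendsto_const_nhds
  have hsum : Tendsto (fun k => ∑ i, ∑ j, curvDistribution r sch k (deg i + deg j) (H' i j)) P.𝒰
      (𝓝 (∑ i, ∑ j, P.S (deg i + deg j) (Fin.append (lab i ∘ Fin.rev) (lab j)) (H i j))) :=
    tendsto_finsetSum _ fun i _ => tendsto_finsetSum _ fun j _ => hterm i j
  set z := ∑ i, ∑ j, P.S (deg i + deg j) (Fin.append (lab i ∘ Fin.rev) (lab j)) (H i j) with hz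
  have hre : ∀ ε : ℝ, 0 < ε → -ε ≤ z.re ∧ |z.im| ≤ ε := by
    intro ε hε
    have hev : ∀ᶠ k in (P.𝒰 : Filter ℕ),
        -ε ≤ (∑ i, ∑ j, curvDistribution r sch k (deg i + deg j) (H' i j)).re ∧
          |(∑ i, ∑ j, curvDistribution r sch k (deg i + deg j) (H' i j)).im| ≤ ε :=
      P.le_atTop (hARP N deg F' hF' H' hH' ε hε)
    exact ⟨ge_of_tendsto ((Complex.continuous_re.tendsto z).comp hsum) (hev.mono fun k hk => hk.1),
      le_of_tendsto ((continuous_abs.tendsto z.im).comp ((Complex.continuous_im.tendsto z).comp hsum))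
        (hev.mono fun k hk => hk.2)⟩
  refine ⟨?_, ?_⟩
  · by_contra hlt
    push Not at hlt
    have := (hre (-z.re / 2) (by linarith)).1
    linarith
  · have h : |z.im| ≤ 0 := le_of_forall_gt_imp_ge_of_dense fun ε hε => (hre ε hε).2
    exact abs_eq_zero.1 (le_antisymm h (abs_nonneg _))

/-- E0-hermiticity of the zero-extension (from E2 and E0, §F). -/
theorem hermitian (hARP : ARP r sch) : P.S.IsHermitian :=
  isHermitian_of_isReflectionPositive P.S (P.reflectionPositive hARP) P.normalized

/-- The OS data of the corrected stub. -/
def osData (hα : ∃ (s : ℕ) (α β : ℝ), 0 ≤ α ∧ ∀ (p : ℕ) (F : 𝓢((Fin p → 𝔼), ℂ)), IsOffDiagonal F →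
      ‖P.Λ p F‖ ≤ α * (p.factorial : ℝ) ^ β * schwartzNorm (p * s) F)
    (hE1 : AsympEuclid r sch) (hARP : ARP r sch) (hUCL : UCL r sch) : OSData (YMSpecies G) 4 :=
  OSData.ofAxioms P.S
    { normalized := P.normalized
      hermitian := P.hermitian hARP
      invariant := P.invariant hE1
      reflectionPositive := P.reflectionPositive hARP
      symmetric := P.symmetric
      cluster := P.cluster hUCL
      linearGrowth := by
        obtain ⟨s, α, β, hα, hbd⟩ := hα
        exact P.linearGrowth hα hbd }

/-- `IsYangMillsFor` for the zero-extension along the canonical scheme. -/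
theorem isYangMillsFor (hconv : ConvProducts r sch) (T : OSData (YMSpecies G) 4) (hT : T.schwinger = P.S) :
    IsYangMillsFor r (canon r sch) T := by
  intro n hn σ f F hF hoff
  rw [hT]
  rcases labels_dichotomy r σ with rfl | ⟨i, hi⟩
  · -- curvature string: `ConvProducts` + `curvDistribution_tensor`
    have hFt : F = SchwartzMap.tensorFin n fun i => ofRealTest (f i) := hF.unique (isTensorOf_tensorFin _)
    obtain ⟨c, hc⟩ := hconv n hn f (hFt ▸ hoff)
    have hΛ : P.Λ n F = (c : ℂ) := by
      refine P.Λ_eq_of_tendsto hoff ?_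
      simp_rw [curvDistribution_tensor r sch _ _ hF]
      exact (Complex.continuous_ofReal.tendsto c).comp hc
    show Tendsto (fun k : ℕ => ((latticeSchwinger r.ρ (canon r sch) (fun s => s.F) k n (fun _ => r.curvature) f
      : ℝ) : ℂ)) atTop (𝓝 (zeroExt r P.Λ n (fun _ => r.curvature) F))
    rw [zeroExt_curv, hΛ]
    simp_rw [latticeSchwinger_canon_curv]
    exact (Complex.continuous_ofReal.tendsto c).comp hc
  · show Tendsto _ atTop (𝓝 (zeroExt r P.Λ n σ F))
    rw [zeroExt_of_ne r P.Λ hi]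
    simp_rw [latticeSchwinger_canon_eq_zero r sch _ n σ f hi, Complex.ofReal_zero]
    exact tendsto_const_nhds

/-- `IsNontrivial` from `ND2`. -/
theorem isNontrivial (hND2 : ND2 r sch) (T : OSData (YMSpecies G) 4) (hT : T.schwinger = P.S) :
    T.IsNontrivial r.curvature := by
  obtain ⟨F, G₁, H, hF, hG, hH, δ, hδ, hev⟩ := hND2
  refine ⟨F, G₁, H, hF, hG, hH, ?_⟩
  rw [hT]
  show zeroExt r P.Λ (1 + 1) (fun _ => r.curvature) H ≠
    zeroExt r P.Λ 1 (fun _ => r.curvature) (osAdjoint F) * zeroExt r P.Λ 1 (fun _ => r.curvature) G₁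
  rw [zeroExt_curv, zeroExt_curv, P.Λ_one G₁, mul_zero]
  have h : δ ≤ ‖P.Λ (1 + 1) H‖ := P.le_norm_Λ (isOffDiagonal_of_isAppendTensorOf_zero hF hG hH) hev
  intro h0
  rw [h0, norm_zero] at h
  linarith

/-- `IsNonGaussian` from `ND3` (one-point functions vanish, so `κ₃ = 𝔖₃`). -/
theorem isNonGaussian (hND3 : ND3 r sch) (T : OSData (YMSpecies G) 4) (hT : T.schwinger = P.S) :
    T.IsNonGaussian r.curvature := by
  obtain ⟨f, g, h, F₃, hF₃, hoff, δ, hδ, hev⟩ := hND3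
  refine ⟨f, g, h, F₃, SchwartzMap.tensorFin 2 ![g, h], SchwartzMap.tensorFin 2 ![f, h],
    SchwartzMap.tensorFin 2 ![f, g], SchwartzMap.tensorFin 1 ![f], SchwartzMap.tensorFin 1 ![g],
    SchwartzMap.tensorFin 1 ![h], hF₃, hoff, isTensorOf_tensorFin _, isTensorOf_tensorFin _,
    isTensorOf_tensorFin _, isTensorOf_tensorFin _, isTensorOf_tensorFin _, isTensorOf_tensorFin _, ?_⟩
  rw [hT]
  show zeroExt r P.Λ 3 (fun _ => r.curvature) F₃ - _ - _ - _ + _ ≠ 0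
  simp only [zeroExt_curv, P.Λ_one, zero_mul, sub_zero, mul_zero, add_zero]
  have hb : δ ≤ ‖P.Λ 3 F₃‖ := P.le_norm_Λ hoff hev
  intro h0
  rw [h0, norm_zero] at hb
  linarith

end LimitPkg

/-- **The corrected stub holds.** -/
theorem oneFieldOSLegs' : OneFieldOSLegs' := by
  intro G _ _ _ _ _ _ r sch hconv hUVB hE1 hARP hUCL hND2 hND3
  obtain ⟨𝒰, h𝒰, s, α, β, hα, Λ, hlim, hbd⟩ := exists_limitFunctionals r sch hUVB
  let P : LimitPkg r sch := ⟨𝒰, h𝒰, Λ, hlim⟩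
  have hα' : ∃ (s : ℕ) (α β : ℝ), 0 ≤ α ∧ ∀ (p : ℕ) (F : 𝓢((Fin p → 𝔼), ℂ)), IsOffDiagonal F →
      ‖P.Λ p F‖ ≤ α * (p.factorial : ℝ) ^ β * schwartzNorm (p * s) F := ⟨s, α, β, hα, hbd⟩
  refine ⟨P.osData hα' hE1 hARP hUCL, P.isYangMillsFor hconv _ rfl, P.isNontrivial hND2 _ rfl,
    P.isNonGaussian hND3 _ rfl⟩

/-- **REGISTERED STUB `stub_osPackaging` of skeleton v2** (= the corrected one-field OS legs, proved above). -/
theorem stub_osPackaging : OneFieldOSLegs' :=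
  oneFieldOSLegs'

end Assembly


end Summit.QuantumFields.YangMills.Cruxes.ContinuumLimitOnTrajectory.TwoOrbitSynchronisation

end
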